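import Literature.NumberTheory.NumberFields.CMFieldQuadraticLayerRealUnit
import HarnessLib

/-!
# No capitulation in a quadratic CM layer `L/M`: `Cl(M) → Cl(L)` is injective when the roots of unity of `L` lie in `M`, `L` has no purely
# imaginary unit, `h(M⁺)` is odd and `L/M`, `L/L⁺` have the ramification of a `ℤ₂`-layer (Ferrero 1980 §3 / Kida 1979 bookkeeping; proved)

Topic `NumberTheory/NumberFields` (namespace = path).  THEOREM-ONLY file (no definition, no named fact, no instance, no `sorry`), written by the prover
seat `bsd-line-att-p3` g31 (cell `bsd-f1-sign2`; `--supports` stmt-BirchSwinnertonDyer-22298; closes nothing).  Abstract form of the no-capitulation step of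
Ferrero's / Kida's computation of `λ₂` for imaginary quadratic fields, to be applied (sequel, `IwasawaTheory/ImaginaryQuadraticTwoTowerNoCapitulation.lean`) to
two consecutive layers `K_n ⊂ K_{n+1}` of the cyclotomic `ℤ₂`-extension of `K = ℚ(√−d)`, `d ≡ 3 (mod 4)`.

SETTING.  `M ⊆ L` CM number fields, `[L : M] = 2`, `σ` the non-trivial `M`-automorphism of `L`, `c` complex conjugation (of `L`; it restricts to that of `M`,
`complexConj_algebraMap`, and commutes with `σ`, `complexConj_algEquiv`), `L⁺ ⊇ M⁺` the maximal real subfields.  HYPOTHESES: (T) every root of unity of `L`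
is fixed by `Gal(L/M)` (i.e. lies in `M`); (NPI) no unit `ε` of `L` has `ε̄ = −ε`; (ODD) `h(M⁺)` is odd; (RAM) for every prime `w` of `M` RAMIFIED over `M⁺` and
every prime `W` of `L` above `w`: `e(W ∣ w) = 1` and `e(W ∣ W ∩ L⁺) = e(w ∣ w ∩ M⁺)`.

THEOREM `classGroupExtend_injective_of_cmLayer`: **then `i_{L/M} : Cl(M) → Cl(L)` is injective.**

PROOF (finite, element-level).  Let `𝔞 𝓞_L = (α)`.  Then `σα = εα` with a unit `ε`, `ε·σε = 1`; `θ = ε/ε̄` is a root of unity with `σθ = θ⁻¹` (`σε = ε⁻¹`,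
`σ` commutes with `c`), so (T) gives `θ² = 1`; `θ = −1` is excluded by (NPI), hence `ε̄ = ε`, `ε ∈ L⁺`.  HILBERT 90 for the quadratic layer, explicitly:
`β = 1 + ε⁻¹` (if `ε ≠ −1`; if `ε = −1`, `β = z + z̄` or `z·δ` with `z = x − σx`, `δ ∈ M` purely imaginary) is a non-zero REAL integer of `L` with `σβ = εβ`.
Then `α/β` is `σ`-fixed, so lies in `M`: `𝔞 𝓞_L = (m)(β)𝓞_L`, and the fractional ideal `𝔟 = 𝔞 (m)⁻¹` of `M` (class `[𝔞]`) has `𝔟 𝓞_L = (β) 𝓞_L` with `β ∈ 𝓞_{L⁺}`.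
VALUATIONS: `(β)𝓞_L` is `c`-invariant, hence so are the exponents of `𝔟` under `Gal(M/M⁺) = {1, c}` (conjugate primes `W, cW` of `L` over `w, cw` have the same
`e`); at a prime `w` of `M` ramified over `M⁺`, (RAM) gives `ord_w 𝔟 = ord_W(𝔟𝓞_L) = ord_W((β)) = e(W∣W∩L⁺)·ord((β)_{L⁺}) ≡ 0 (mod e(w∣w∩M⁺))`.  So `𝔟 = 𝔟₀ 𝓞_M` for a
fractional ideal `𝔟₀` of `M⁺` (ambiguous with exponents divisible by the `e`'s — Lang XIII §4 Lemma 4.1, tree `IdealExponentsGaloisAction`), `[𝔞] = i_{M/M⁺}[𝔟₀]` has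
ODD order by (ODD), and `[𝔞]² = 1` (`N ∘ i = 2`): `[𝔞] = 1`.

Not found in print in this form (Ferrero 1980 §3 and Kida 1979 prove `A_n → A_m` injective for `ℚ(√−d)` by a units/genus computation; Washington Prop. 13.26 is
the odd-`p` analogue); ingredients cited at each use (D-0014: our proof assembled from cited ingredients).  presearch: «capitulation cyclotomic Z_2-extension
imaginary quadratic» → [corpus: paper:arxiv-1211.1727 (Schettler 2014) Thm. 2 = the λ-formula, proof at infinite level]; galaxy none.

References: [Ferrero1980AJM] B. Ferrero, Amer. J. Math. 102 (1980) 447–459, §3; [Kida1979Tohoku] Y. Kida, Tôhoku Math. J. 31 (1979) 91–96; [Washington1997] L. Washington,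
*Introduction to Cyclotomic Fields*, Thm. 10.3, Prop. 13.26, §13.3; [Lang1990] S. Lang, *Cyclotomic Fields I–II*, Ch. 13 §4 Lemma 4.1; [NeukirchANT1999] Ch. III §1 (1.6).
-/

set_option autoImplicit false

noncomputable section

open NumberField NumberField.IsCMField NumberField.Units IsDedekindDomain FractionalIdeal
open scoped nonZeroDivisors Pointwise

namespace Literature.NumberTheory.NumberFields

open Literature.NumberTheory.NumberFields.AmbiguousClass Literature.NumberTheory.NumberFields.AmbiguousIdeal
  Literature.NumberTheory.Automorphic Literature.NumberTheory.GaloisRepresentations Literature.NumberTheory.GaloisRepresentations.Herbrand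

namespace CMLayer

variable (M L : Type) [Field M] [NumberField M] [Field L] [NumberField L] [Algebra M L] [IsCMField M] [IsCMField L]

/-! ## §4 Conjugate primes: `(c_L W) ∩ M = c_M (W ∩ M)` and `e(c_L W ∣ c_M w) = e(W ∣ w)` -/

omit [NumberField L] [IsCMField M] [IsCMField L] in
/-- There is a prime of `L` above every prime of `M` (lying over). [cite: NeukirchANT1999, Ch. I §9 (9.1) (primes above a prime in an integral extension)] -/
theorem exists_under_eq (w : HeightOneSpectrum (𝓞 M)) : ∃ W : HeightOneSpectrum (𝓞 L), W.under (𝓞 M) = w := by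
  haveI : w.asIdeal.IsMaximal := w.isMaximal
  obtain ⟨Q, hQ, hQw⟩ := Ideal.exists_maximal_ideal_liesOver_of_isIntegral (S := 𝓞 L) w.asIdeal
  refine ⟨⟨Q, hQ.isPrime, Ideal.ne_bot_of_liesOver_of_ne_bot w.ne_bot Q⟩, HeightOneSpectrum.ext hQw.over.symm⟩

/-- The ring-of-integers maps intertwine the two complex conjugations: `c_L ∘ alg = alg ∘ c_M` on `𝓞 M → 𝓞 L`. [cite: Washington1997, §4 (before Thm. 4.12)] -/
theorem intAut_comp_algebraMap :
    (intAut (complexConj L) : 𝓞 L →+* 𝓞 L).comp (algebraMap (𝓞 M) (𝓞 L)) =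
      (algebraMap (𝓞 M) (𝓞 L)).comp (intAut (complexConj M) : 𝓞 M →+* 𝓞 M) := by
  ext x
  change complexConj L (algebraMap M L (x : M)) = algebraMap M L (complexConj M (x : M))
  exact complexConj_algebraMap M L (x : M)

omit [NumberField M] [IsCMField M] in
/-- `c_L² = 1` (complex conjugation is an involution). [cite: Washington1997, §4 (before Thm. 4.12)] -/
theorem complexConj_mul_self : complexConj L * complexConj L = 1 := by
  ext x; exact complexConj_apply_apply L x

/-- **Extension commutes with conjugation on ideals**: `(c_M • 𝔧)𝓞_L = c_L • (𝔧 𝓞_L)`. [cite: CasselsFrohlichANT1967, Ch. VII §1.1] -/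
theorem map_complexConj_smul (J : Ideal (𝓞 M)) :
    ((complexConj M) • J).map (algebraMap (𝓞 M) (𝓞 L)) = (complexConj L) • J.map (algebraMap (𝓞 M) (𝓞 L)) := by
  rw [smul_ideal_eq_map, smul_ideal_eq_map, Ideal.map_map, Ideal.map_map, intAut_comp_algebraMap M L]

/-- **Conjugate primes lie over conjugate primes**: `(c_L • W) ∩ 𝓞_M = c_M • (W ∩ 𝓞_M)`. [cite: CasselsFrohlichANT1967, Ch. VII §1.1] -/
theorem under_complexConj_smul (W : HeightOneSpectrum (𝓞 L)) :
    ((complexConj L) • W).under (𝓞 M) = (complexConj M) • W.under (𝓞 M) := by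
  symm
  apply HeightOneSpectrum.ext
  -- `c_M • w ≤ (c_L • W) ∩ 𝓞_M`, and both are maximal
  have hle : ((complexConj M) • W.under (𝓞 M)).asIdeal ≤ (((complexConj L) • W).under (𝓞 M)).asIdeal := by
    rw [HeightOneSpectrum.under_asIdeal, Ideal.under_def, ← Ideal.map_le_iff_le_comap, HeightOneSpectrum.smul_asIdeal,
      HeightOneSpectrum.under_asIdeal, map_complexConj_smul M L, HeightOneSpectrum.smul_asIdeal]
    refine Ideal.pointwise_smul_le_pointwise_smul_iff.mpr ?_
    rw [Ideal.map_le_iff_le_comap, ← Ideal.under_def, ← HeightOneSpectrum.under_asIdeal]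
  exact (((complexConj M) • W.under (𝓞 M)).isMaximal.eq_of_le (((complexConj L) • W).under (𝓞 M)).isPrime.ne_top hle)

/-- **Conjugate primes have the same ramification index over `M`**: `e(c_L W ∣ c_M w) = e(W ∣ w)` (`w = W ∩ 𝓞_M`), read off the exponents
`e(W ∣ w) = ord_W(w𝓞_L)` (Neukirch I (8.2)) and `ord_{c W}(c 𝔍) = ord_W(𝔍)`. [cite: CasselsFrohlichANT1967, Ch. VII §1.1] [cite: NeukirchANT1999, Ch. I §8 Prop. (8.2)] -/
theorem ramificationIdx_complexConj_smul (W : HeightOneSpectrum (𝓞 L)) :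
    ((complexConj L) • W).asIdeal.ramificationIdx (𝓞 M) = W.asIdeal.ramificationIdx (𝓞 M) := by
  set w := W.under (𝓞 M) with hw
  have hw0 : w.asIdeal ≠ ⊥ := w.ne_bot
  have hcw0 : ((complexConj M) • w).asIdeal ≠ ⊥ := ((complexConj M) • w).ne_bot
  have hJ0 : w.asIdeal.map (algebraMap (𝓞 M) (𝓞 L)) ≠ ⊥ :=
    (Ideal.map_eq_bot_iff_of_injective (FaithfulSMul.algebraMap_injective (𝓞 M) (𝓞 L))).not.mpr hw0
  have h1 := count_coeIdeal_map M L W (J := w.asIdeal) hw0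
  rw [← hw, FractionalIdeal.count_self, mul_one] at h1
  have h2 := count_coeIdeal_map M L ((complexConj L) • W) (J := ((complexConj M) • w).asIdeal) hcw0
  rw [under_complexConj_smul M L W, ← hw, FractionalIdeal.count_self, mul_one, HeightOneSpectrum.smul_asIdeal, map_complexConj_smul M L,
    count_smul_coeIdeal (complexConj L) W hJ0] at h2
  exact_mod_cast h2.symm.trans h1

/-! ## §5 The theorem -/

/-- ★ **No capitulation in a quadratic CM layer.**  `M ⊆ L` CM number fields with `[L : M] = 2`; (T) the roots of unity of `L` are fixed by `Gal(L/M)`; (NPI) no unit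
`ε` of `L` has `ε̄ = −ε`; (ODD) `h(M⁺)` odd; (RAM) for every prime `w` of `M` ramified over `M⁺` and every prime `W` of `L` above it, `e(W ∣ w) = 1` and
`e(W ∣ W ∩ L⁺) = e(w ∣ w ∩ M⁺)`.  THEN **`i_{L/M} : Cl(M) → Cl(L)` is injective.**  (Proof in the module docstring: reality of `σα/α`, explicit Hilbert 90 with a real
integral solution, descent of `𝔞` to an ideal extended from `M⁺` through conjugation-invariant exponents, odd order against `[𝔞]² = 1`.)
[cite: Ferrero1980AJM, §3] [cite: Kida1979Tohoku, Thm. 1 (proof)] [cite: Washington1997, Thm. 10.3 and Prop. 13.26] [cite: Lang1990, Ch. 13 §4 Lemma 4.1] -/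
theorem classGroupExtend_injective_of_cmLayer (h2 : Module.finrank M L = 2)
    (hodd : Odd (classNumber ↥(maximalRealSubfield M)))
    (hT : ∀ (σ : L ≃ₐ[M] L) (x : L) (n : ℕ), 0 < n → x ^ n = 1 → σ x = x)
    (hNPI : ∀ u : (𝓞 L)ˣ, complexConj L ((u : 𝓞 L) : L) ≠ -((u : 𝓞 L) : L))
    (hram : ∀ w : HeightOneSpectrum (𝓞 M), w.asIdeal.ramificationIdx (𝓞 ↥(maximalRealSubfield M)) ≠ 1 →
      ∀ W : HeightOneSpectrum (𝓞 L), W.under (𝓞 M) = w →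
        W.asIdeal.ramificationIdx (𝓞 M) = 1 ∧
          W.asIdeal.ramificationIdx (𝓞 ↥(maximalRealSubfield L)) = w.asIdeal.ramificationIdx (𝓞 ↥(maximalRealSubfield M))) :
    Function.Injective (classGroupExtend M L) := by
  classical
  obtain ⟨σ, hσ, hσσ⟩ := exists_algEquiv_ne_one M L h2
  rw [injective_iff_map_eq_one]
  intro c hc
  -- (1) generator, unit, reality, Hilbert 90, descent
  have hsq : c ^ 2 = 1 := by rw [← h2]; exact pow_finrank_eq_one_of_classGroupExtend_eq_one M L hc
  obtain ⟨𝔞, h𝔞, α, rfl, hα, hα0⟩ := exists_rep_of_classGroupExtend_eq_one M L hc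
  obtain ⟨u, hu⟩ := exists_unit_algEquiv_eq_mul M L σ hα
  have hα0' : (α : L) ≠ 0 := by exact_mod_cast hα0
  have hun : ((u : 𝓞 L) : L) * σ ((u : 𝓞 L) : L) = 1 := unit_mul_algEquiv_unit_eq_one M L hσσ hα0' hu
  have hreal := complexConj_unit_eq_self M L σ (hT σ) hNPI u hun
  obtain ⟨β, hβ0, hβreal, hβσ⟩ := exists_real_integer_algEquiv_eq_mul M L hσ hσσ u hun hreal
  obtain ⟨m₁, m₂, hm₂0, hαβ⟩ := exists_integers_mul_eq_mul M L h2 hσ hβ0 hu hβσ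
  obtain ⟨b, hb⟩ := (IsCMField.RingOfIntegers.complexConj_eq_self_iff L β).mp hβreal
  have hbβ : algebraMap (𝓞 ↥(maximalRealSubfield L)) (𝓞 L) b = β := RingOfIntegers.ext (by
    rw [← hb]; exact (IsScalarTower.algebraMap_apply (𝓞 ↥(maximalRealSubfield L)) (𝓞 L) L b).symm)
  have hb0 : (Ideal.span {b} : Ideal (𝓞 ↥(maximalRealSubfield L))) ≠ ⊥ := by
    rw [Ne, Ideal.span_singleton_eq_bot]
    rintro rfl
    rw [map_zero] at hb
    exact hβ0 hb.symm
  have hm₁0 : (m₁ : M) ≠ 0 := by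
    intro h0
    rw [h0, map_zero, zero_mul] at hαβ
    exact (mul_ne_zero hα0' ((_root_.map_ne_zero _).mpr hm₂0)) hαβ
  have hm₁I : (Ideal.span {m₁} : Ideal (𝓞 M)) ≠ ⊥ := by
    rw [Ne, Ideal.span_singleton_eq_bot]; rintro rfl; exact hm₁0 rfl
  have hm₂I : (Ideal.span {m₂} : Ideal (𝓞 M)) ≠ ⊥ := by
    rw [Ne, Ideal.span_singleton_eq_bot]; rintro rfl; exact hm₂0 rfl
  have hβI : (Ideal.span {β} : Ideal (𝓞 L)) ≠ ⊥ := by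
    rw [Ne, Ideal.span_singleton_eq_bot]; rintro rfl; exact hβ0 rfl
  -- (2) the fractional ideal `𝔟 = 𝔞 (m₂) (m₁)⁻¹` of `M` and `(β)` of `L`
  set A : (FractionalIdeal (𝓞 M)⁰ M)ˣ := FractionalIdeal.mk0 M ⟨𝔞, mem_nonZeroDivisors_of_ne_zero h𝔞⟩ with hA
  set P₁ : (FractionalIdeal (𝓞 M)⁰ M)ˣ := FractionalIdeal.mk0 M ⟨Ideal.span {m₁}, mem_nonZeroDivisors_of_ne_zero hm₁I⟩ with hP₁
  set P₂ : (FractionalIdeal (𝓞 M)⁰ M)ˣ := FractionalIdeal.mk0 M ⟨Ideal.span {m₂}, mem_nonZeroDivisors_of_ne_zero hm₂I⟩ with hP₂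
  set 𝔟 : (FractionalIdeal (𝓞 M)⁰ M)ˣ := A * P₂ * P₁⁻¹ with h𝔟
  set B : (FractionalIdeal (𝓞 L)⁰ L)ˣ := FractionalIdeal.mk0 L ⟨Ideal.span {β}, mem_nonZeroDivisors_of_ne_zero hβI⟩ with hB
  set ι := (Units.map (extendedHom L (𝓞 L) : FractionalIdeal (𝓞 M)⁰ M →+* FractionalIdeal (𝓞 L)⁰ L).toMonoidHom) with hι
  have hιval : ∀ (J : Ideal (𝓞 M)) (hJ : J ≠ ⊥),
      ((ι (FractionalIdeal.mk0 M ⟨J, mem_nonZeroDivisors_of_ne_zero hJ⟩) : (FractionalIdeal (𝓞 L)⁰ L)ˣ) : FractionalIdeal (𝓞 L)⁰ L) =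
        ((J.map (algebraMap (𝓞 M) (𝓞 L)) : Ideal (𝓞 L)) : FractionalIdeal (𝓞 L)⁰ L) := fun J hJ => by
    rw [hι, Units.coe_map, RingHom.toMonoidHom_eq_coe, MonoidHom.coe_coe, FractionalIdeal.coe_mk0]
    exact extendedHom_coeIdeal_eq_map L (𝓞 L) J
  have hext : ι 𝔟 = B := by
    apply Units.ext
    have hBval : ((B : (FractionalIdeal (𝓞 L)⁰ L)ˣ) : FractionalIdeal (𝓞 L)⁰ L) = spanSingleton (𝓞 L)⁰ (β : L) := by
      rw [hB, FractionalIdeal.coe_mk0]; exact coeIdeal_span_singleton β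
    rw [hBval, h𝔟, map_mul, map_mul, map_inv, Units.val_mul, Units.val_mul, Units.val_inv_eq_inv_val, hιval 𝔞 h𝔞, hιval _ hm₁I, hιval _ hm₂I, hα,
      Ideal.map_span, Set.image_singleton, Ideal.map_span, Set.image_singleton, coeIdeal_span_singleton, coeIdeal_span_singleton, coeIdeal_span_singleton,
      spanSingleton_mul_spanSingleton, spanSingleton_inv, spanSingleton_mul_spanSingleton]
    congr 1
    have hm₁L : algebraMap M L (m₁ : M) ≠ 0 := (_root_.map_ne_zero _).mpr hm₁0
    change (α : L) * algebraMap M L (m₂ : M) * (algebraMap M L (m₁ : M))⁻¹ = (β : L)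
    rw [hαβ]; field_simp
  -- (3) exponents: `e(W∣w)·ord_w 𝔟 = e(W∣W∩L⁺)·ord((b))` for every prime `W` of `L`
  have hcount : ∀ W : HeightOneSpectrum (𝓞 L),
      (W.asIdeal.ramificationIdx (𝓞 M) : ℤ) * count M (W.under (𝓞 M)) (𝔟 : FractionalIdeal (𝓞 M)⁰ M) =
        (W.asIdeal.ramificationIdx (𝓞 ↥(maximalRealSubfield L)) : ℤ) *
          count ↥(maximalRealSubfield L) (W.under (𝓞 ↥(maximalRealSubfield L)))
            ((Ideal.span {b} : Ideal (𝓞 ↥(maximalRealSubfield L))) : FractionalIdeal (𝓞 ↥(maximalRealSubfield L))⁰ ↥(maximalRealSubfield L)) := by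
    intro W
    have h1 := count_extendedHom M L W 𝔟
    have h2 := count_coeIdeal_map ↥(maximalRealSubfield L) L W (J := Ideal.span {b}) hb0
    rw [Ideal.map_span, Set.image_singleton, hbβ] at h2
    have h3 : extendedHom L (𝓞 L) (𝔟 : FractionalIdeal (𝓞 M)⁰ M) = ((Ideal.span {β} : Ideal (𝓞 L)) : FractionalIdeal (𝓞 L)⁰ L) := by
      have := congrArg (fun I : (FractionalIdeal (𝓞 L)⁰ L)ˣ => (I : FractionalIdeal (𝓞 L)⁰ L)) hext
      simpa [hι, hB] using this
    rw [h3, h2] at h1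
    exact h1.symm
  -- (4) `𝔟` has conjugation-invariant exponents, i.e. is an ambiguous ideal of `M/M⁺`
  have hBinv : (complexConj L) • B = B := by
    apply Units.ext
    rw [coe_smul_fracIdeal, hB, FractionalIdeal.coe_mk0]
    change fracIdealAut (complexConj L) (((Ideal.span {β} : Ideal (𝓞 L))) : FractionalIdeal (𝓞 L)⁰ L) = _
    rw [coeIdeal_span_singleton, fracIdealAut_spanSingleton]
    change spanSingleton (𝓞 L)⁰ (complexConj L (β : L)) = _
    rw [hβreal]
  have hinv : ∀ w : HeightOneSpectrum (𝓞 M), count M ((complexConj M) • w) (𝔟 : FractionalIdeal (𝓞 M)⁰ M) = count M w (𝔟 : FractionalIdeal (𝓞 M)⁰ M) := by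
    intro w
    obtain ⟨W, hW⟩ := exists_under_eq M L w
    have hW' : ((complexConj L) • W).under (𝓞 M) = (complexConj M) • w := by rw [under_complexConj_smul M L W, hW]
    have h1 := hcount W
    have h2 := hcount ((complexConj L) • W)
    rw [hW] at h1
    rw [hW', ramificationIdx_complexConj_smul M L W] at h2
    -- the right-hand sides agree: `B` is `c_L`-invariant
    have hB1 : count L ((complexConj L) • W) (B : FractionalIdeal (𝓞 L)⁰ L) = count L W (B : FractionalIdeal (𝓞 L)⁰ L) := by
      conv_lhs => rw [← hBinv]
      exact count_smul (complexConj L) W B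
    have hR : ∀ V : HeightOneSpectrum (𝓞 L), (V.asIdeal.ramificationIdx (𝓞 ↥(maximalRealSubfield L)) : ℤ) *
        count ↥(maximalRealSubfield L) (V.under (𝓞 ↥(maximalRealSubfield L)))
          ((Ideal.span {b} : Ideal (𝓞 ↥(maximalRealSubfield L))) : FractionalIdeal (𝓞 ↥(maximalRealSubfield L))⁰ ↥(maximalRealSubfield L)) =
        count L V (B : FractionalIdeal (𝓞 L)⁰ L) := by
      intro V
      have h := count_coeIdeal_map ↥(maximalRealSubfield L) L V (J := Ideal.span {b}) hb0
      rw [Ideal.map_span, Set.image_singleton, hbβ] at h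
      rw [hB, FractionalIdeal.coe_mk0]
      exact h.symm
    rw [hR] at h1 h2
    rw [hB1, ← h1] at h2
    have he0 : (W.asIdeal.ramificationIdx (𝓞 M) : ℤ) ≠ 0 := by
      have : W.asIdeal.ramificationIdx (𝓞 M) ≠ 0 := by
        haveI := W.isPrime
        exact (Ideal.ramificationIdx_pos W.asIdeal (𝓞 M)).ne'
      exact_mod_cast this
    exact mul_left_cancel₀ he0 h2
  have h𝔟fix : (complexConj M) • 𝔟 = 𝔟 := by
    refine units_ext_count M fun w => ?_
    rw [count_smul' (complexConj M) w 𝔟]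
    have hcc : (complexConj M)⁻¹ = complexConj M := by
      rw [inv_eq_iff_mul_eq_one]; ext x; exact complexConj_apply_apply M x
    rw [hcc, hinv]
  have h𝔟Z : 𝔟 ∈ z0 (complexConj M) (⊤ : Subgroup (FractionalIdeal (𝓞 M)⁰ M)ˣ) ⊥ := mem_z0_bot.mpr ⟨Subgroup.mem_top _, h𝔟fix⟩
  have hgen : ∀ τ : M ≃ₐ[↥(maximalRealSubfield M)] M, τ ∈ Subgroup.zpowers (complexConj M) := fun τ => by
    rw [zpowers_complexConj_eq_top]; exact Subgroup.mem_top τ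
  -- (5) divisibility of the exponents by the ramification indices of `M/M⁺`
  have hdvd : ∀ w : HeightOneSpectrum (𝓞 M),
      ((w.asIdeal.ramificationIdx (𝓞 ↥(maximalRealSubfield M)) : ℕ) : ℤ) ∣ count M w (𝔟 : FractionalIdeal (𝓞 M)⁰ M) := by
    intro w
    by_cases he : w.asIdeal.ramificationIdx (𝓞 ↥(maximalRealSubfield M)) = 1
    · rw [he, Nat.cast_one]; exact one_dvd _
    · obtain ⟨W, hW⟩ := exists_under_eq M L w
      obtain ⟨heW, heW'⟩ := hram w he W hW
      have h := hcount W
      rw [hW, heW, Nat.cast_one, one_mul, heW'] at h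
      exact Dvd.intro _ h.symm
  -- (6) `𝔟 = 𝔟₀ 𝓞_M` for a fractional ideal `𝔟₀` of `M⁺`
  choose s hs using exists_under_eq ↥(maximalRealSubfield M) M
  have hsinj : Function.Injective s := fun a b h => by rw [← hs a, ← hs b, h]
  obtain ⟨𝔟₀, h𝔟₀⟩ := exists_units_count_eq ↥(maximalRealSubfield M)
    (fun v => count M (s v) (𝔟 : FractionalIdeal (𝓞 M)⁰ M) / (((s v).asIdeal.ramificationIdx (𝓞 ↥(maximalRealSubfield M)) : ℕ) : ℤ)) (by
      rw [Filter.eventually_cofinite]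
      refine ((finite_setOf_count_ne_zero M 𝔟).preimage hsinj.injOn).subset fun v hv => ?_
      intro h0
      apply hv
      show count M (s v) (𝔟 : FractionalIdeal (𝓞 M)⁰ M) / (((s v).asIdeal.ramificationIdx (𝓞 ↥(maximalRealSubfield M)) : ℕ) : ℤ) = 0
      rw [h0, Int.zero_ediv])
  have h𝔟eq : Units.map (extendedHom M (𝓞 M) : FractionalIdeal (𝓞 ↥(maximalRealSubfield M))⁰ ↥(maximalRealSubfield M) →+* FractionalIdeal (𝓞 M)⁰ M).toMonoidHom 𝔟₀ = 𝔟 := by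
    refine units_ext_count M fun w => ?_
    rw [Units.coe_map, RingHom.toMonoidHom_eq_coe, MonoidHom.coe_coe, count_extendedHom ↥(maximalRealSubfield M) M w 𝔟₀, h𝔟₀,
      count_eq_of_under_eq hgen h𝔟Z (hs (w.under (𝓞 ↥(maximalRealSubfield M)))),
      ramificationIdx_eq_ramificationIdxIn ↥(maximalRealSubfield M) M (s (w.under (𝓞 ↥(maximalRealSubfield M)))), hs,
      ← ramificationIdx_eq_ramificationIdxIn ↥(maximalRealSubfield M) M w]
    exact Int.mul_ediv_cancel' (hdvd w)
  -- (7) classes: `[𝔞] = [𝔟] = i_{M/M⁺}[𝔟₀]` has odd order and square `1`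
  have hcl : ClassGroup.mk0 ⟨𝔞, mem_nonZeroDivisors_of_ne_zero h𝔞⟩ = ClassGroup.mk M 𝔟 := by
    rw [h𝔟, map_mul, map_mul, map_inv, ← ClassGroup.mk_mk0 M, ← hA]
    have h1 : ClassGroup.mk M P₁ = 1 := by rw [hP₁, ClassGroup.mk_mk0, ClassGroup.mk0_eq_one_iff]; exact ⟨⟨m₁, rfl⟩⟩
    have h2' : ClassGroup.mk M P₂ = 1 := by rw [hP₂, ClassGroup.mk_mk0, ClassGroup.mk0_eq_one_iff]; exact ⟨⟨m₂, rfl⟩⟩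
    rw [h1, h2', inv_one, mul_one, mul_one]
  have hcl' : ClassGroup.mk0 ⟨𝔞, mem_nonZeroDivisors_of_ne_zero h𝔞⟩ =
      classGroupExtend ↥(maximalRealSubfield M) M (ClassGroup.mk ↥(maximalRealSubfield M) 𝔟₀) := by
    rw [classGroupExtend_mk, h𝔟eq, hcl]
  -- odd order
  have hord : Odd (orderOf (ClassGroup.mk0 (⟨𝔞, mem_nonZeroDivisors_of_ne_zero h𝔞⟩ : (Ideal (𝓞 M))⁰))) := by
    rw [hcl']
    have h1 := orderOf_map_dvd (classGroupExtend ↥(maximalRealSubfield M) M) (ClassGroup.mk ↥(maximalRealSubfield M) 𝔟₀)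
    have h2' := orderOf_dvd_card (x := ClassGroup.mk ↥(maximalRealSubfield M) 𝔟₀)
    rw [← classNumber] at h2'
    exact Odd.of_dvd_nat hodd (h1.trans h2')
  have h2dvd : orderOf (ClassGroup.mk0 (⟨𝔞, mem_nonZeroDivisors_of_ne_zero h𝔞⟩ : (Ideal (𝓞 M))⁰)) ∣ 2 := orderOf_dvd_of_pow_eq_one hsq
  have h1 : orderOf (ClassGroup.mk0 (⟨𝔞, mem_nonZeroDivisors_of_ne_zero h𝔞⟩ : (Ideal (𝓞 M))⁰)) = 1 := by
    rcases (Nat.dvd_prime Nat.prime_two).mp h2dvd with h | h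
    · exact h
    · exfalso; rw [h] at hord; exact (Nat.not_even_iff_odd.mpr hord) even_two
  exact orderOf_eq_one_iff.mp h1

end CMLayer

end Literature.NumberTheory.NumberFields

end
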